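import Summits.CriticalPhenomena.PercolationContinuityZ3.Theses.PercNearOneGluing
import Literature.Probability.Percolation.PercolationProofs
import Literature.Probability.Percolation.ConditionalPositiveAssociationProofs
import Literature.Probability.Percolation.TwoClusterConditionalAssociationProofs

/-! TTRL-lite variant V178 of stmt-CriticalPhenomena-4576 -/

namespace Summit.CriticalPhenomena.PercolationContinuityZ3.Theorems

open MeasureTheory Literature.Probability.LatticeModels Literature.Probability.Percolation
open scoped Classical BigOperators

/-- TTRL-lite variant V178 of `stmt-CriticalPhenomena-4576` (moves `bound_nat:n≤4; card_eq:A=3`).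
With `n ≤ 4`, `A.card = 3` and `o ∉ A`, the set `A ∪ {o}` exhausts `Fin n`, so the hypothesis
`∃ y ∉ A, y ≠ o ∧ …` is contradictory and the statement holds vacuously (pigeonhole). -/
theorem stub_goodStep_var178 :
    ∀ (n : ℕ) (w : Sym2 (Fin n) → unitInterval) (A : Finset (Fin n)) (o b : Fin n), A.card = 3 → n ≤ 4 → b ∈ A → o ∉ A → (∃ y : Fin n, y ∉ A ∧ y ≠ o ∧ (w s(o, y) : ℝ) ≠ 0) → (∀ w' : Sym2 (Fin n) → unitInterval, (Finset.univ.filter (fun v : Fin n => ∃ u : Fin n, 0 < (w' s(u, v) : ℝ))).card < (Finset.univ.filter (fun v : Fin n => ∃ u : Fin n, 0 < (w s(u, v) : ℝ))).card → ∀ (A' : Finset (Fin n)) (o' b' : Fin n), b' ∈ A' → o' ∉ A' → ∀ (t : ℝ) (sel : Finset (Fin n) → Fin n), (∀ W, sel W ∈ A') → (∀ a ∈ A', 1 - t ≤ (prodBernoulli w').real (openConn a b')) → (prodBernoulli w').real ((⋃ a ∈ A', openConn o' a) ∩ (openConn o' b')ᶜ) + ∑ W ∈ (Finset.univ : Finset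 (Finset (Fin n))).filter (fun W => o' ∈ W ∧ Disjoint W A'), (prodBernoulli w').real {ω : BondConfig (Fin n) | openCluster ω o' = (W : Set (Fin n))} * (prodBernoulli w').real (openConnIn ((W : Set (Fin n))ᶜ) (sel W) b')ᶜ ≤ t) → ∀ (t : ℝ) (sel : Finset (Fin n) → Fin n), (∀ W, sel W ∈ A) → (∀ a ∈ A, 1 - t ≤ (prodBernoulli w).real (openConn a b)) → (prodBernoulli w).real ((⋃ a ∈ A, openConn o a) ∩ (openConn o b)ᶜ) + ∑ W ∈ (Finset.univ : Finset (Finset (Fin n))).filter (fun W => o ∈ W ∧ Disjoint W A), (prodBernoulli w).real {ω : BondConfig (Fin n) | openCluster ω o = (W : Set (Fin n))} * (prodBernoulli w).real (openConnIn ((W : Set (Fin n))ᶜ) (sel W) b)ᶜ ≤ t := by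
  intro n w A o b hA hn _hb ho hy
  exfalso
  obtain ⟨y, hyA, hyo, -⟩ := hy
  have hoy : o ∉ insert y A := by
    simp only [Finset.mem_insert, not_or]
    exact ⟨fun h => hyo h.symm, ho⟩
  have hcard : (insert o (insert y A)).card ≤ n := by
    calc (insert o (insert y A)).card ≤ (Finset.univ : Finset (Fin n)).card :=
          Finset.card_le_univ _
      _ = n := by simp
  rw [Finset.card_insert_of_notMem hoy, Finset.card_insert_of_notMem hyA] at hcard
  omega

end Summit.CriticalPhenomena.PercolationContinuityZ3.Theorems
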